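import Literature.AlgebraicGeometry.Resolution.TameCyclicMonomialStructure
import Literature.AlgebraicGeometry.Resolution.LocalBlowup
import HarnessLib

/-!
# One more tame cyclic step on a ring with monomially generated maximal ideal (abelian tame groups)

Topic: `Literature/AlgebraicGeometry/Resolution`. PROOF side of `CossartPiltant2019ReductionP`
(`ArithmeticalThreefoldsLocal.lean`), input (C4), toric route (`TameCyclicToricDescent.lean`).
At the Kummer-covering invocation site of `hC4` (`ArithmeticalThreefoldsLocalTameAscent.lean`)
the tame Galois group is ABELIAN of exponent `ℓ`, acting diagonally on joint eigen-parameters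
`x₁, …, x_d` of the regular local ring upstairs through commuting automorphisms `σ₁, …, σ_r`.
Its ring of invariants is reached by ITERATING the cyclic step: this file proves the induction
step — if `C ⊆ O` is a `τ`-stable Noetherian local subring dominated by `O` whose maximal ideal is
generated by finitely many monomials `x^{g_i}` in `τ`-eigenvectors `xⱼ` (`τ xⱼ = ζ^{sⱼ} xⱼ`),
and `τ` is tame (`ℓ ∈ C^×`, `ζ ∈ C`) and residually trivial on `C`, then the ring of invariants
`C' = C ∩ F^τ` is again a Noetherian local subring dominated by `O` whose maximal ideal is
generated by finitely many monomials `x^{g'_k}`, each `g'_k` an `ℕ`-combination of the `g_i`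
with `ℓ ∣ s·g'_k` ([CoP1] Prop. 6.2 (2) and proof of Lemma 9.4 for one cyclic factor:
`TameCyclicFixedRing.lean`, `TameCyclicMonomialStructure.lean`). After `r` steps the exponents
lie in `N = ⋂ₖ ker(s_k · −) ⊇ ℓℤ^d` and `ToricChartRegularity.exists_toricChart_isRegularLocalRing_of_addSubgroup`
applies.

* `exists_monomial_generators_fixedSubring` — PROVED.

Everything is PROVED; no named facts are introduced.

## Sources

* V. Cossart, O. Piltant, *Resolution of singularities of threefolds in positive characteristic.
  I*, J. Algebra 320 (2008) 1051–1082: Prop. 6.2 (2) (28)–(30) and proof of Lemma 9.4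
  (HAL hal-00139124, pp. 19, 28–29). [CossartPiltant2008]
-/

noncomputable section

namespace Literature.AlgebraicGeometry.Resolution

universe u

open IsLocalRing

section Step

variable {F : Type u} [Field F] (O : ValuationSubring F)

/-- **The cyclic step on a monomially generated maximal ideal** ([CoP1] Prop. 6.2 (2) and proof
of Lemma 9.4, one cyclic factor of an abelian tame group). Let `τ` be an automorphism of the
field `F` with `τ^ℓ = 1`, `O` a valuation ring of `F`, `C ⊆ O` a `τ`-stable Noetherian local
subring dominated by `O` with `ℓ ∈ C^×` and an `ℓ`-th root of unity `ζ ∈ C`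
(`ζ^k - 1 ∈ C^×` for `0 < k < ℓ`), `τ` residually trivial on `C`; let `x₁, …, x_d ∈ F` be
`τ`-eigenvectors, `τ xⱼ = ζ^{sⱼ} xⱼ`, and suppose `𝔪_C` is generated by monomials
`x^{g_1}, …, x^{g_m} ∈ C`. Then the ring of invariants `C' = {c ∈ C : τ c = c}` is a Noetherian
local subring dominated by `O` whose maximal ideal is generated by finitely many monomials
`x^{g'_k} ∈ C'`, each `g'_k = ∑ᵢ wᵢ g_i` with `wᵢ ∈ ℕ` and `ℓ ∣ ∑ⱼ sⱼ g'_{kj}`.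
[cite: CossartPiltant2008, Prop. 6.2 (2) (28)–(30) and proof of Lemma 9.4 (HAL pp. 19, 29)] -/
theorem exists_monomial_generators_fixedSubring (τ : F ≃+* F) {ℓ : ℕ} (hℓ0 : ℓ ≠ 0)
    (hτℓ : τ ^ ℓ = 1) (C : Subring F) [IsLocalRing C] [IsNoetherianRing C]
    (hdomC : ∀ c : C, c ∈ maximalIdeal C ↔ O.valuation (c : F) < 1)
    (hτC : ∀ c ∈ C, τ c ∈ C) (hℓu : IsUnit ((ℓ : C)))
    (ζ : F) (hζC : ζ ∈ C) (hτζ : τ ζ = ζ) (hζℓ : ζ ^ ℓ = 1)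
    (hζu : ∀ k : ℕ, 0 < k → k < ℓ → IsUnit ((⟨ζ, hζC⟩ : C) ^ k - 1))
    (hres : ∀ c ∈ C, O.valuation (τ c - c) < 1)
    {d : ℕ} (x : Fin d → F) (s : Fin d → ℕ) (hτx : ∀ j, τ (x j) = ζ ^ s j * x j)
    {m : ℕ} (g : Fin m → (Fin d → ℕ)) (hgC : ∀ i, (∏ j, x j ^ g i j) ∈ C)
    (hspan : Ideal.span (Set.range fun i => (⟨∏ j, x j ^ g i j, hgC i⟩ : C)) = maximalIdeal C)
    (C' : Subring F) (hC' : ∀ b, b ∈ C' ↔ b ∈ C ∧ τ b = b) :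
    ∃ (_ : IsLocalRing C') (_ : IsNoetherianRing C'),
      (∀ c : C', c ∈ maximalIdeal C' ↔ O.valuation (c : F) < 1) ∧
      ∃ (m' : ℕ) (g' : Fin m' → (Fin d → ℕ)) (hg'C : ∀ k, (∏ j, x j ^ g' k j) ∈ C'),
        (∀ k, ∃ w : Fin m → ℕ, g' k = ∑ i, w i • g i) ∧
        (∀ k, ℓ ∣ ∑ j, s j * g' k j) ∧
        Ideal.span (Set.range fun k => (⟨∏ j, x j ^ g' k j, hg'C k⟩ : C')) = maximalIdeal C' := by
  classical
  have hℓpos : 0 < ℓ := Nat.pos_of_ne_zero hℓ0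
  -- `τ⁻¹ = τ^(ℓ-1)` preserves `C`
  have hτsymm : ∀ b : F, τ.symm b = (τ ^ (ℓ - 1)) b := fun b => by
    rw [RingEquiv.symm_apply_eq]
    change b = (τ * τ ^ (ℓ - 1)) b
    rw [← pow_succ', Nat.sub_add_cancel hℓpos, hτℓ]
    rfl
  have hτpowC : ∀ (k : ℕ) (b : F), b ∈ C → (τ ^ k) b ∈ C := by
    intro k
    induction k with
    | zero => intro b hb; exact hb
    | succ k ih => intro b hb; rw [pow_succ', RingAut.mul_apply]; exact hτC _ (ih b hb)
  have hτC' : ∀ b ∈ C, τ.symm b ∈ C := fun b hb => by rw [hτsymm]; exact hτpowC _ b hb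
  -- `τ` restricted to `C`
  let σ : C ≃+* C :=
    { toFun := fun b => ⟨τ b, hτC b b.2⟩
      invFun := fun b => ⟨τ.symm b, hτC' b b.2⟩
      left_inv := fun b => Subtype.ext (τ.symm_apply_apply b)
      right_inv := fun b => Subtype.ext (τ.apply_symm_apply b)
      map_mul' := fun a b => Subtype.ext (map_mul τ (a : F) (b : F))
      map_add' := fun a b => Subtype.ext (map_add τ (a : F) (b : F)) }
  have hσ_apply : ∀ b : C, ((σ b : C) : F) = τ b := fun b => rfl
  have hσpow : ∀ (k : ℕ) (b : C), (((σ ^ k) b : C) : F) = (τ ^ k) (b : F) := by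
    intro k
    induction k with
    | zero => intro b; rfl
    | succ k ih => intro b; rw [pow_succ', RingAut.mul_apply, pow_succ', RingAut.mul_apply, hσ_apply, ih]
  have hσℓ : σ ^ ℓ = 1 := RingEquiv.ext fun b => Subtype.ext (by rw [hσpow, hτℓ]; rfl)
  let ζC : C := ⟨ζ, hζC⟩
  have hσζ : σ ζC = ζC := Subtype.ext hτζ
  have hζCℓ : ζC ^ ℓ = 1 := Subtype.ext (by
    change ((ζC ^ ℓ : C) : F) = 1
    rw [SubmonoidClass.coe_pow]; exact hζℓ)
  have hresC : ∀ b : C, σ b - b ∈ maximalIdeal C := fun b => (hdomC _).mpr (hres b b.2)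
  -- the generators as eigenvectors in `C`
  let xg : Fin m → C := fun i => ⟨∏ j, x j ^ g i j, hgC i⟩
  let t : Fin m → ℕ := fun i => ∑ j, s j * g i j
  have hτmon : ∀ w : Fin d → ℕ, τ (∏ j, x j ^ w j) = ζ ^ (∑ j, s j * w j) * ∏ j, x j ^ w j := by
    intro w
    calc τ (∏ j, x j ^ w j) = ∏ j, (ζ ^ s j * x j) ^ w j := by
          rw [map_prod]; exact Finset.prod_congr rfl fun j _ => by rw [map_pow, hτx]
      _ = ζ ^ (∑ j, s j * w j) * ∏ j, x j ^ w j := by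
          rw [← Finset.prod_pow_eq_pow_sum, ← Finset.prod_mul_distrib]
          exact Finset.prod_congr rfl fun j _ => by rw [mul_pow, pow_mul]
  have hx : ∀ i, σ (xg i) = ζC ^ (t i) * xg i := fun i => Subtype.ext (by
    change τ (∏ j, x j ^ g i j) = ((ζC ^ t i * xg i : C) : F)
    rw [Subring.coe_mul, SubmonoidClass.coe_pow, hτmon])
  -- the ring of invariants inside `C`
  let AB : Subring C := C'.comap C.subtype
  have hAB : ∀ b : C, b ∈ AB ↔ σ b = b := fun b => by
    change (b : F) ∈ C' ↔ _
    rw [hC', Subtype.ext_iff, hσ_apply]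
    exact ⟨fun h => h.2, fun h => ⟨b.2, h⟩⟩
  haveI hABloc : IsLocalRing AB := isLocalRing_fixedSubring σ AB hAB
  haveI : IsNoetherianRing AB :=
    isNoetherianRing_fixedSubring_of_tameCyclic σ AB hAB hℓ0 hσℓ hℓu ζC hσζ hζCℓ
  have hmax := maximalIdeal_fixedSubring_eq_span_monomials σ AB hAB hℓ0 hσℓ hℓu ζC hσζ hζCℓ
    hζu xg t hx hresC hspan
  -- transport to `C' ⊆ F`
  have hC'le : C' ≤ C := fun a ha => ((hC' a).mp ha).1
  let e : AB ≃+* C' :=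
    { toFun := fun a => ⟨((a : C) : F), a.2⟩
      invFun := fun a => ⟨⟨(a : F), hC'le a.2⟩, a.2⟩
      left_inv := fun a => rfl
      right_inv := fun a => rfl
      map_mul' := fun a b => rfl
      map_add' := fun a b => rfl }
  have he : ∀ a : AB, ((e a : C') : F) = ((a : C) : F) := fun a => rfl
  haveI hC'loc : IsLocalRing C' := e.isLocalRing
  haveI hC'noe : IsNoetherianRing C' := isNoetherianRing_of_ringEquiv AB e
  -- units of `C'` are the units of `C` in `C'`
  have hunit : ∀ a : C', IsUnit a ↔ IsUnit (⟨(a : F), hC'le a.2⟩ : C) := by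
    intro a
    refine ⟨fun h => h.map (Subring.inclusion hC'le), fun h => ?_⟩
    obtain ⟨v, hv⟩ := h.exists_right_inv
    have hv' : (a : F) * (v : F) = 1 := by
      have := congrArg Subtype.val hv
      simpa using this
    have hτa : τ (a : F) = a := ((hC' _).mp a.2).2
    have hτv : τ (v : F) = v := by
      have h1 : (a : F) * τ (v : F) = 1 := by
        have := congrArg τ hv'
        rwa [map_mul, hτa, map_one] at this
      calc τ (v : F) = τ (v : F) * ((a : F) * (v : F)) := by rw [hv', mul_one]
        _ = ((a : F) * τ (v : F)) * (v : F) := by ring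
        _ = v := by rw [h1, one_mul]
    exact IsUnit.of_mul_eq_one (⟨(v : F), (hC' _).mpr ⟨v.2, hτv⟩⟩ : C') (Subtype.ext hv')
  have hdom' : ∀ c : C', c ∈ maximalIdeal C' ↔ O.valuation (c : F) < 1 := fun c => by
    rw [IsLocalRing.mem_maximalIdeal, mem_nonunits_iff, hunit, ← mem_nonunits_iff,
      ← IsLocalRing.mem_maximalIdeal, hdomC]
  -- the new exponent vectors: `W = ∑ wᵢ gᵢ` for the box exponents `w` of the invariant monomials
  let box : Finset (Fin m → ℕ) :=
    (Fintype.piFinset fun _ : Fin m => Finset.range (ℓ + 1)).filter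
      (fun w => w ≠ 0 ∧ (∑ i, t i * w i) % ℓ = 0)
  have hbox : ∀ w, w ∈ box ↔ (∀ i, w i ≤ ℓ) ∧ w ≠ 0 ∧ (∑ i, t i * w i) % ℓ = 0 := fun w => by
    simp only [box, Finset.mem_filter, Fintype.mem_piFinset, Finset.mem_range, Nat.lt_succ_iff]
  let m' := box.card
  let wOf : Fin m' → (Fin m → ℕ) := fun k => ((box.equivFin.symm k : box) : Fin m → ℕ)
  have hwOf : ∀ k, wOf k ∈ box := fun k => (box.equivFin.symm k).2
  let g' : Fin m' → (Fin d → ℕ) := fun k => ∑ i, wOf k i • g i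
  -- the monomial identity `∏ᵢ (x^{gᵢ})^{wᵢ} = x^{∑ wᵢ gᵢ}`
  have hmonid : ∀ w : Fin m → ℕ, (∏ i, (∏ j, x j ^ g i j) ^ w i) = ∏ j, x j ^ (∑ i, w i • g i) j :=
    fun w => by
    simp only [Finset.sum_apply, Pi.smul_apply, smul_eq_mul]
    calc (∏ i, (∏ j, x j ^ g i j) ^ w i) = ∏ i, ∏ j, x j ^ (w i * g i j) := by
          refine Finset.prod_congr rfl fun i _ => ?_
          rw [← Finset.prod_pow]
          exact Finset.prod_congr rfl fun j _ => by rw [← pow_mul, mul_comm]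
      _ = ∏ j, ∏ i, x j ^ (w i * g i j) := Finset.prod_comm
      _ = ∏ j, x j ^ ∑ i, w i * g i j :=
          Finset.prod_congr rfl fun j _ => Finset.prod_pow_eq_pow_sum _ _ _
  -- divisibility `ℓ ∣ s·g'_k` and membership `x^{g'_k} ∈ C'`
  have hsg : ∀ w : Fin m → ℕ, (∑ j, s j * (∑ i, w i • g i) j) = ∑ i, t i * w i := fun w => by
    simp only [Finset.sum_apply, Pi.smul_apply, smul_eq_mul, Finset.mul_sum, t, Finset.sum_mul]
    rw [Finset.sum_comm]
    exact Finset.sum_congr rfl fun i _ => Finset.sum_congr rfl fun j _ => by ring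
  have hdiv : ∀ k, ℓ ∣ ∑ j, s j * g' k j := fun k => by
    change ℓ ∣ ∑ j, s j * (∑ i, wOf k i • g i) j
    rw [hsg]
    exact Nat.dvd_of_mod_eq_zero ((hbox _).mp (hwOf k)).2.2
  have hmonC : ∀ w : Fin m → ℕ, (∏ j, x j ^ (∑ i, w i • g i) j) ∈ C := fun w => by
    rw [← hmonid]; exact C.prod_mem fun i _ => C.pow_mem (hgC i) _
  have hg'C : ∀ k, (∏ j, x j ^ g' k j) ∈ C' := fun k => by
    rw [hC']
    refine ⟨hmonC _, ?_⟩
    obtain ⟨q, hq⟩ := hdiv k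
    change τ (∏ j, x j ^ (∑ i, wOf k i • g i) j) = ∏ j, x j ^ (∑ i, wOf k i • g i) j
    rw [hτmon]
    change ζ ^ (∑ j, s j * g' k j) * _ = _
    rw [hq, pow_mul, hζℓ, one_pow, one_mul]
  -- the generators of `𝔪_{C'}`
  have hgen : (e : AB →+* C') '' {a : AB | ∃ w : Fin m → ℕ, (∀ i, w i ≤ ℓ) ∧ w ≠ 0 ∧
      (∑ i, t i * w i) % ℓ = 0 ∧ (a : C) = ∏ i, xg i ^ w i} =
      Set.range fun k => (⟨∏ j, x j ^ g' k j, hg'C k⟩ : C') := by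
    ext c
    constructor
    · rintro ⟨a, ⟨w, hwℓ, hw0, hwt, haw⟩, rfl⟩
      have hwbox : w ∈ box := (hbox w).mpr ⟨hwℓ, hw0, hwt⟩
      refine ⟨box.equivFin ⟨w, hwbox⟩, Subtype.ext ?_⟩
      have hwk : wOf (box.equivFin ⟨w, hwbox⟩) = w := by
        change ((box.equivFin.symm (box.equivFin ⟨w, hwbox⟩) : box) : Fin m → ℕ) = w
        rw [Equiv.symm_apply_apply]
      change (∏ j, x j ^ (∑ i, wOf (box.equivFin ⟨w, hwbox⟩) i • g i) j) = ((a : C) : F)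
      rw [hwk, ← hmonid, haw]
      push_cast
      rfl
    · rintro ⟨k, rfl⟩
      have hmem : (⟨∏ i, xg i ^ wOf k i, ?_⟩ : AB) ∈ {a : AB | ∃ w : Fin m → ℕ, (∀ i, w i ≤ ℓ) ∧
          w ≠ 0 ∧ (∑ i, t i * w i) % ℓ = 0 ∧ (a : C) = ∏ i, xg i ^ w i} :=
        ⟨wOf k, ((hbox _).mp (hwOf k)).1, ((hbox _).mp (hwOf k)).2.1, ((hbox _).mp (hwOf k)).2.2, rfl⟩
      swap
      · -- membership in `AB`: the element lies in `C'`
        change ((∏ i, xg i ^ wOf k i : C) : F) ∈ C'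
        have : ((∏ i, xg i ^ wOf k i : C) : F) = ∏ j, x j ^ g' k j := by
          push_cast
          exact hmonid _
        rw [this]; exact hg'C k
      refine ⟨_, hmem, Subtype.ext ?_⟩
      change ((∏ i, xg i ^ wOf k i : C) : F) = ∏ j, x j ^ g' k j
      push_cast
      exact hmonid _
  refine ⟨hC'loc, hC'noe, hdom', m', g', hg'C, fun k => ⟨wOf k, rfl⟩, hdiv, ?_⟩
  rw [← hgen, ← Ideal.map_span, ← hmax]
  exact IsLocalRing.map_ringEquiv_maximalIdeal e

end Step

end Literature.AlgebraicGeometry.Resolution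

end
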